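import Mathlib
import Summits.Ventures.HodgeRepro.Tier4.Target
import Summits.Ventures.HodgeRepro.Tier4.Line3.Defs
import Summits.Ventures.HodgeRepro.Tier4.Line3.DefsLemmas
import Summits.Ventures.HodgeRepro.Tier4.Line3.KMDatum
import Summits.Ventures.HodgeRepro.Tier4.Line3.KMDatumS
import Summits.Ventures.HodgeRepro.Tier4.Line3.HeckeEquivarianceLemmas
import Summits.Ventures.HodgeRepro.Tier4.Line3.ClassBoundGauss
import Summits.Ventures.HodgeRepro.Tier4.Line3.Majorant
import Summits.Ventures.HodgeRepro.Tier4.Line3.SylvesterTransfer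
import Summits.Ventures.HodgeRepro.Tier4.Line3.UnitCopyScaling
import Summits.Ventures.HodgeRepro.Tier4.Line3.UnitCopyPos
import Summits.Ventures.HodgeRepro.Tier4.Line3.CopyRemainder
import Summits.Ventures.HodgeRepro.Tier4.Line3.GaussRatioFormula
import Summits.Ventures.HodgeRepro.Tier4.Line3.CopyWeightBound
import Summits.Ventures.HodgeRepro.Tier4.Line3.CopyWeightGaussian
import Summits.Ventures.HodgeRepro.Tier4.Line3.CopyWeightBoundShrink

/-!
# Tier4/Line3/CopyWeightBoundShrinkRed — the weight of EVERY copy with the SIGNED profile exponent, under the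
exponential-moment bound of the REDUCED majorant

Blind re-derivation cell `pub-hodge-repro`, Tier 4 «PROVE THE STEP», LINE L3, seat t4-x2 (g3, reserve wall-breaker); the
self-correction of bus S14086.  CopyWeightBoundShrink (p686953) displays the exponential moments of the RAW majorant
`maj(y_j, z)`; along the integer ray `xm ↦ n • xm` those moments grow like `e^{+π n² s_j tauSize (xm j)}` relative to the
main term (both are Laplace integrals concentrated at the point `z*` where every `maj(y_j, ·)` attains its minimum
`tauSize (xm j)`), so that display is not uniform in `n`.  The uniform display is the same bound for the REDUCED majorant

  `maj(y_j, z) − tauSize (xm j) ≥ 0`   (CopyWeightGaussian `tauSize_le_maj`):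

`MajorantMomentBoundRed D xm A k` («(HK′)»).  With it the weight of EVERY copy is bounded with the SIGNED profile exponent
`profileExc ε xm = Σ_j (t_j² − 1) tauSize (xm j) + defSize ε xm` (CopyWeightGaussian):

  `weight c o ≤ shrinkMajRed A k ε xm · ‖Λ(o)‖ · Re I_∞(xm)`,
  `shrinkMajRed A k ε xm = A · ∏_j t_j² · ∏_j (min 1 t_j²)^{−k} · exp(−π profileExc ε xm)`

(`weight_le_shrinkMajRed`): a shrinking slot (`t_j < 1`) is AMPLIFIED by `e^{+π (1 − t_j²) tauSize (xm j)}` — the Laplace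
exponent, the honest content of bus S13860 (F4).  Comparison with the one-sided majorant: `shrinkMajRed ≤ e^{π Σ_j tauSize (xm j)}
· shrinkMaj` (`shrinkMajRed_le_shrinkMaj`), so the Gaussian domination (ShrinkMajGauss) and the `Summable` half of the count
(CopyCountShrink) carry over; on non-shrinking copies the two majorants agree (`shrinkMajRed_of_one_le`).

Nothing here says anything about the status of the Hodge conjecture for CM abelian varieties, which is NOT proved
(HC_CM is NOT proved by anyone in this repository).
-/

set_option autoImplicit false

noncomputable section

namespace Summit.Ventures.HodgeRepro.Tier4.Line3

open Summit.Ventures.HodgeRepro.Tier4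
open Matrix NumberField MeasureTheory
open scoped ComplexConjugate

namespace T4Data

variable (X : T4Data)

/-- **(HK′) THE EXPONENTIAL-MOMENT BOUND OF THE REDUCED MAJORANT** `maj − tauSize` under the main kernel (DISPLAYED): for
every `s ∈ [0, 1)⁴` the function `e^{π Σ_j s_j (maj(y_j, z) − tauSize (xm j))} · Re kernel(xm, z)` is integrable on the ball
with integral `≤ A · ∏_j (1 − s_j)^{−k} · Re I_∞(xm)`. -/
def MajorantMomentBoundRed (D : X.ThetaData) (xm : X.Tuple) (A k : ℝ) : Prop :=
  ∀ s : Fin 4 → ℝ, (∀ j, 0 ≤ s j ∧ s j < 1) →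
    IntegrableOn (fun z => Real.exp (Real.pi * ∑ j, s j * (maj (X.ballCoord (xm j)) z - X.tauSize (xm j))) *
      (X.kernel D.Φ xm z).re) ball ∧
    ∫ z in ball, Real.exp (Real.pi * ∑ j, s j * (maj (X.ballCoord (xm j)) z - X.tauSize (xm j))) *
      (X.kernel D.Φ xm z).re ≤
      A * (∏ j, (1 - s j) ^ (-k)) * (∫ z in ball, X.kernel D.Φ xm z).re

/-- **THE CLOSED-FORM MAJORANT WITH THE SIGNED PROFILE EXPONENT.** -/
def shrinkMajRed (A k : ℝ) (ε : Fin 4 → X.E) (x : X.Tuple) : ℝ :=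
  A * (∏ j, ‖X.τ₀ (ε j)‖ ^ 2) * (∏ j, (min 1 (‖X.τ₀ (ε j)‖ ^ 2)) ^ (-k)) * Real.exp (-(Real.pi * X.profileExc ε x))

/-- The pointwise split with the reduced majorant: on the ball,
`exp(−π (t² − 1) maj) ≤ exp(π s (maj − h)) · exp(−π (t² − 1) h)` with `s = max 0 (1 − t²)`, `h = tauSize`. -/
theorem exp_scale_le_red (ε : Fin 4 → X.E) (x : X.Tuple) (j : Fin 4) {z : Fin 2 → ℂ} (hz : z ∈ ball) :
    Real.exp (-(Real.pi * ((‖X.τ₀ (ε j)‖ ^ 2 - 1) * maj (X.ballCoord (x j)) z))) ≤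
      Real.exp (Real.pi * (X.shrinkParam ε j * (maj (X.ballCoord (x j)) z - X.tauSize (x j)))) *
        Real.exp (-(Real.pi * ((‖X.τ₀ (ε j)‖ ^ 2 - 1) * X.tauSize (x j)))) := by
  rw [← Real.exp_add]
  apply Real.exp_le_exp.2
  have hm : 0 ≤ maj (X.ballCoord (x j)) z - X.tauSize (x j) := sub_nonneg.2 (X.tauSize_le_maj (x j) hz)
  have hp : 0 ≤ max 0 (‖X.τ₀ (ε j)‖ ^ 2 - 1) := le_max_left _ _
  -- `−(t² − 1) = s − (t² − 1)⁺`
  have hsplit : -(‖X.τ₀ (ε j)‖ ^ 2 - 1) = X.shrinkParam ε j - max 0 (‖X.τ₀ (ε j)‖ ^ 2 - 1) := by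
    unfold shrinkParam
    rcases le_total 1 (‖X.τ₀ (ε j)‖ ^ 2) with h | h
    · rw [max_eq_left (by linarith), max_eq_right (by linarith)]
      ring
    · rw [max_eq_right (by linarith), max_eq_left (by linarith)]
      ring
  have h1 : 0 ≤ max 0 (‖X.τ₀ (ε j)‖ ^ 2 - 1) * (maj (X.ballCoord (x j)) z - X.tauSize (x j)) := mul_nonneg hp hm
  -- `−(t²−1) maj = −(t²−1) h + (s − (t²−1)⁺)(maj − h)`
  have h2 : -(Real.pi * ((‖X.τ₀ (ε j)‖ ^ 2 - 1) * maj (X.ballCoord (x j)) z)) =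
      Real.pi * (X.shrinkParam ε j * (maj (X.ballCoord (x j)) z - X.tauSize (x j))) +
        -(Real.pi * ((‖X.τ₀ (ε j)‖ ^ 2 - 1) * X.tauSize (x j))) -
        Real.pi * (max 0 (‖X.τ₀ (ε j)‖ ^ 2 - 1) * (maj (X.ballCoord (x j)) z - X.tauSize (x j))) := by
    linear_combination (Real.pi * (maj (X.ballCoord (x j)) z - X.tauSize (x j))) * hsplit
  rw [h2]
  nlinarith [Real.pi_pos, h1]

/-- The kernel scaling factor of ANY copy, on the ball, against the reduced moments:
`kernelScale ≤ (∏ t_j²) · e^{π Σ s_j (maj_j − h_j)} · e^{−π Σ (t_j² − 1) h_j}`. -/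
theorem kernelScale_le_shrink_red (ε : Fin 4 → X.E) (x : X.Tuple) {z : Fin 2 → ℂ} (hz : z ∈ ball) :
    X.kernelScale ε x z ≤ (∏ j, ‖X.τ₀ (ε j)‖ ^ 2) *
      (Real.exp (Real.pi * ∑ j, X.shrinkParam ε j * (maj (X.ballCoord (x j)) z - X.tauSize (x j))) *
        Real.exp (-(Real.pi * ∑ j, (‖X.τ₀ (ε j)‖ ^ 2 - 1) * X.tauSize (x j)))) := by
  unfold kernelScale
  have hexp : Real.exp (Real.pi * ∑ j, X.shrinkParam ε j * (maj (X.ballCoord (x j)) z - X.tauSize (x j))) *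
      Real.exp (-(Real.pi * ∑ j, (‖X.τ₀ (ε j)‖ ^ 2 - 1) * X.tauSize (x j))) =
      ∏ j, (Real.exp (Real.pi * (X.shrinkParam ε j * (maj (X.ballCoord (x j)) z - X.tauSize (x j)))) *
        Real.exp (-(Real.pi * ((‖X.τ₀ (ε j)‖ ^ 2 - 1) * X.tauSize (x j))))) := by
    rw [Finset.prod_mul_distrib, ← Real.exp_sum, ← Real.exp_sum, Finset.mul_sum, Finset.mul_sum,
      ← Finset.sum_neg_distrib]
  rw [hexp, ← Finset.prod_mul_distrib]
  refine Finset.prod_le_prod (fun j _ => mul_nonneg (pow_nonneg (norm_nonneg _) 2) (Real.exp_pos _).le)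
    fun j _ => ?_
  exact mul_le_mul_of_nonneg_left (X.exp_scale_le_red ε x j hz) (pow_nonneg (norm_nonneg _) 2)

/-- **THE WEIGHT OF ANY COPY AGAINST THE MAIN TERM, WITH THE SIGNED PROFILE EXPONENT, UNDER (HK′).** -/
theorem weight_le_shrinkMajRed (D : X.ThetaData) (S : Set (Fin 4 → X.E)) (xm : X.Tuple) (h02 : xm 2 = xm 0)
    (h13 : xm 3 = xm 1) {A k : ℝ} (hHK : X.MajorantMomentBoundRed D xm A k) (c : X.CopyData D S xm) (o : X.Orbit)
    (hε : ∀ j, c.rep o j ≠ 0) :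
    c.weight o ≤ X.shrinkMajRed A k (c.rep o) xm * ‖c.lam o 0 * c.lam o 1 * conj (c.lam o 2 * c.lam o 3)‖ *
      (∫ z in ball, X.kernel D.Φ xm z).re := by
  unfold CopyData.weight
  obtain ⟨hint, hmom⟩ := hHK (X.shrinkParam (c.rep o)) (X.shrinkParam_mem hε)
  set B : ℝ := (∏ j, ‖X.τ₀ (c.rep o j)‖ ^ 2) *
    Real.exp (-(Real.pi * ∑ j, (‖X.τ₀ (c.rep o j)‖ ^ 2 - 1) * X.tauSize (xm j))) with hB
  have hB0 : 0 ≤ B := mul_nonneg (Finset.prod_nonneg fun _ _ => pow_nonneg (norm_nonneg _) 2) (Real.exp_pos _).le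
  have hkr : ∀ z, ‖X.kernel D.Φ xm z‖ = (X.kernel D.Φ xm z).re := fun z => X.norm_kernel_symm D.Φ xm h02 h13 z
  have hkr0 : ∀ z, 0 ≤ (X.kernel D.Φ xm z).re := fun z => (hkr z) ▸ norm_nonneg _
  have hk : ‖∫ z in ball, ((X.kernelScale (c.rep o) xm z : ℝ) : ℂ) * X.kernel D.Φ xm z‖ ≤
      B * ∫ z in ball, Real.exp (Real.pi * ∑ j, X.shrinkParam (c.rep o) j *
        (maj (X.ballCoord (xm j)) z - X.tauSize (xm j))) * (X.kernel D.Φ xm z).re := by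
    refine (norm_integral_le_integral_norm _).trans ?_
    rw [← integral_const_mul]
    refine integral_mono_of_nonneg (Filter.Eventually.of_forall fun z => norm_nonneg _)
      (hint.const_mul _) ?_
    refine ae_restrict_of_forall_mem HeckeEquivariance.isOpen_ball'.measurableSet fun z hz => ?_
    show ‖((X.kernelScale (c.rep o) xm z : ℝ) : ℂ) * X.kernel D.Φ xm z‖ ≤
      B * (Real.exp (Real.pi * ∑ j, X.shrinkParam (c.rep o) j * (maj (X.ballCoord (xm j)) z - X.tauSize (xm j))) *
        (X.kernel D.Φ xm z).re)
    rw [norm_mul, Complex.norm_real, Real.norm_eq_abs, abs_of_nonneg (X.kernelScale_nonneg _ _ _), hkr]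
    have h1 := X.kernelScale_le_shrink_red (c.rep o) xm hz
    calc X.kernelScale (c.rep o) xm z * (X.kernel D.Φ xm z).re
        ≤ ((∏ j, ‖X.τ₀ (c.rep o j)‖ ^ 2) *
          (Real.exp (Real.pi * ∑ j, X.shrinkParam (c.rep o) j * (maj (X.ballCoord (xm j)) z - X.tauSize (xm j))) *
            Real.exp (-(Real.pi * ∑ j, (‖X.τ₀ (c.rep o j)‖ ^ 2 - 1) * X.tauSize (xm j))))) *
          (X.kernel D.Φ xm z).re := mul_le_mul_of_nonneg_right h1 (hkr0 z)
      _ = B * (Real.exp (Real.pi * ∑ j, X.shrinkParam (c.rep o) j * (maj (X.ballCoord (xm j)) z - X.tauSize (xm j))) *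
          (X.kernel D.Φ xm z).re) := by rw [hB]; ring
  have hprod : (∏ j, (1 - X.shrinkParam (c.rep o) j) ^ (-k)) =
      ∏ j, (min 1 (‖X.τ₀ (c.rep o j)‖ ^ 2)) ^ (-k) :=
    Finset.prod_congr rfl fun j _ => by rw [X.one_sub_shrinkParam]
  rw [hprod] at hmom
  have hg0 : 0 ≤ X.gaussRatio (c.rep o) xm := (X.gaussRatio_pos _ _).le
  calc ‖∫ z in ball, ((X.kernelScale (c.rep o) xm z : ℝ) : ℂ) * X.kernel D.Φ xm z‖ *
        ‖c.lam o 0 * c.lam o 1 * conj (c.lam o 2 * c.lam o 3)‖ * X.gaussRatio (c.rep o) xm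
      ≤ (B * ∫ z in ball, Real.exp (Real.pi * ∑ j, X.shrinkParam (c.rep o) j *
          (maj (X.ballCoord (xm j)) z - X.tauSize (xm j))) * (X.kernel D.Φ xm z).re) *
        ‖c.lam o 0 * c.lam o 1 * conj (c.lam o 2 * c.lam o 3)‖ * X.gaussRatio (c.rep o) xm := by
          gcongr
    _ ≤ (B * (A * (∏ j, (min 1 (‖X.τ₀ (c.rep o j)‖ ^ 2)) ^ (-k)) * (∫ z in ball, X.kernel D.Φ xm z).re)) *
        ‖c.lam o 0 * c.lam o 1 * conj (c.lam o 2 * c.lam o 3)‖ * X.gaussRatio (c.rep o) xm := by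
          gcongr
    _ = X.shrinkMajRed A k (c.rep o) xm * ‖c.lam o 0 * c.lam o 1 * conj (c.lam o 2 * c.lam o 3)‖ *
        (∫ z in ball, X.kernel D.Φ xm z).re := by
          rw [X.gaussRatio_eq_exp]
          unfold shrinkMajRed profileExc
          rw [hB]
          have hsplit : Real.exp (-(Real.pi * ((∑ j, (‖X.τ₀ (c.rep o j)‖ ^ 2 - 1) * X.tauSize (xm j)) +
              X.defSize (c.rep o) xm))) =
              Real.exp (-(Real.pi * ∑ j, (‖X.τ₀ (c.rep o j)‖ ^ 2 - 1) * X.tauSize (xm j))) *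
                Real.exp (-(Real.pi * X.defSize (c.rep o) xm)) := by
            rw [← Real.exp_add]; congr 1; ring
          rw [hsplit]
          ring

/-- `(t² − 1) ≥ (t² − 1)⁺ − 1`, so `e^{−π (t²−1) h} ≤ e^{π h} · e^{−π (t²−1)⁺ h}` for `h ≥ 0`: the signed majorant is at most
`e^{π Σ_j tauSize (x j)}` times the one-sided one. -/
theorem shrinkMajRed_le_shrinkMaj {A : ℝ} (hA : 0 ≤ A) (k : ℝ) (ε : Fin 4 → X.E) (x : X.Tuple) :
    X.shrinkMajRed A k ε x ≤ Real.exp (Real.pi * ∑ j, X.tauSize (x j)) * X.shrinkMaj A k ε x := by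
  unfold shrinkMajRed shrinkMaj profileExc
  have h1 : 0 ≤ (∏ j, ‖X.τ₀ (ε j)‖ ^ 2) * ∏ j, (min 1 (‖X.τ₀ (ε j)‖ ^ 2)) ^ (-k) :=
    mul_nonneg (Finset.prod_nonneg fun _ _ => pow_nonneg (norm_nonneg _) 2)
      (Finset.prod_nonneg fun _ _ => Real.rpow_nonneg (by positivity) _)
  have hexp : Real.exp (-(Real.pi * ((∑ j, (‖X.τ₀ (ε j)‖ ^ 2 - 1) * X.tauSize (x j)) + X.defSize ε x))) ≤
      Real.exp (Real.pi * ∑ j, X.tauSize (x j)) *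
        (Real.exp (-(Real.pi * ∑ j, max 0 (‖X.τ₀ (ε j)‖ ^ 2 - 1) * X.tauSize (x j))) *
          Real.exp (-(Real.pi * X.defSize ε x))) := by
    rw [← Real.exp_add, ← Real.exp_add]
    apply Real.exp_le_exp.2
    have hterm : ∀ j, max 0 (‖X.τ₀ (ε j)‖ ^ 2 - 1) * X.tauSize (x j) ≤
        (‖X.τ₀ (ε j)‖ ^ 2 - 1) * X.tauSize (x j) + X.tauSize (x j) := by
      intro j
      have hh := X.tauSize_nonneg (x j)
      rcases le_total 0 (‖X.τ₀ (ε j)‖ ^ 2 - 1) with h | h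
      · rw [max_eq_right h]; linarith
      · rw [max_eq_left h]; nlinarith
    have hsum : ∑ j, max 0 (‖X.τ₀ (ε j)‖ ^ 2 - 1) * X.tauSize (x j) ≤
        (∑ j, (‖X.τ₀ (ε j)‖ ^ 2 - 1) * X.tauSize (x j)) + ∑ j, X.tauSize (x j) := by
      rw [← Finset.sum_add_distrib]
      exact Finset.sum_le_sum fun j _ => hterm j
    nlinarith [Real.pi_pos, hsum]
  calc A * (∏ j, ‖X.τ₀ (ε j)‖ ^ 2) * (∏ j, (min 1 (‖X.τ₀ (ε j)‖ ^ 2)) ^ (-k)) *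
        Real.exp (-(Real.pi * ((∑ j, (‖X.τ₀ (ε j)‖ ^ 2 - 1) * X.tauSize (x j)) + X.defSize ε x)))
      ≤ A * (∏ j, ‖X.τ₀ (ε j)‖ ^ 2) * (∏ j, (min 1 (‖X.τ₀ (ε j)‖ ^ 2)) ^ (-k)) *
        (Real.exp (Real.pi * ∑ j, X.tauSize (x j)) *
          (Real.exp (-(Real.pi * ∑ j, max 0 (‖X.τ₀ (ε j)‖ ^ 2 - 1) * X.tauSize (x j))) *
            Real.exp (-(Real.pi * X.defSize ε x)))) := by
          refine mul_le_mul_of_nonneg_left hexp ?_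
          calc (0 : ℝ) ≤ A * ((∏ j, ‖X.τ₀ (ε j)‖ ^ 2) * ∏ j, (min 1 (‖X.τ₀ (ε j)‖ ^ 2)) ^ (-k)) :=
                mul_nonneg hA h1
            _ = A * (∏ j, ‖X.τ₀ (ε j)‖ ^ 2) * (∏ j, (min 1 (‖X.τ₀ (ε j)‖ ^ 2)) ^ (-k)) := by ring
    _ = Real.exp (Real.pi * ∑ j, X.tauSize (x j)) *
        (A * (∏ j, ‖X.τ₀ (ε j)‖ ^ 2) * (∏ j, (min 1 (‖X.τ₀ (ε j)‖ ^ 2)) ^ (-k)) *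
          Real.exp (-(Real.pi * ∑ j, max 0 (‖X.τ₀ (ε j)‖ ^ 2 - 1) * X.tauSize (x j))) *
          Real.exp (-(Real.pi * X.defSize ε x))) := by ring

/-- On a non-shrinking copy the two majorants agree. -/
theorem shrinkMajRed_of_one_le (A k : ℝ) {ε : Fin 4 → X.E} (hε : ∀ j, 1 ≤ ‖X.τ₀ (ε j)‖) (x : X.Tuple) :
    X.shrinkMajRed A k ε x = X.shrinkMaj A k ε x := by
  rw [X.shrinkMaj_of_one_le A k hε x]
  unfold shrinkMajRed
  have h1 : ∀ j, min 1 (‖X.τ₀ (ε j)‖ ^ 2) = 1 := fun j => min_eq_left (by nlinarith [hε j, norm_nonneg (X.τ₀ (ε j))])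
  simp only [h1, Real.one_rpow, Finset.prod_const_one, mul_one]

end T4Data

end Summit.Ventures.HodgeRepro.Tier4.Line3

end
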